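import Mathlib

set_option linter.dupNamespace false

/-!
# SoloBlindEdoOhnoGenerators — the extended double Ohno involution is a product of three Ohno involutions:
  the generator identities (solo-blind s153)

Kernel certificate for the ring-theoretic identities behind THEOREM A of
`work/s153/edo-note.md` (solo-blind residency on the Kontsevich–Zagier period conjecture, session 153;
falsifier class (S17) F-MZVREL of the residency's certificate).

Setting of the note (Hoffman–Ohno formalism as in Hirose–Murahara–Onozuka–Sato, arXiv:1910.07740 §2,
and Hirose–Sato–Seki, *The connector for the double Ohno relation*, Acta Arith. 201 (2021) =
arXiv:2006.09036, Thm 1.2).  In `𝔥̂ = ℚ⟨⟨x,y⟩⟩[[ξ,η]]` let `τ` be the anti-involution `x ↔ y`,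
`σ_f : y ↦ y(1-xf)⁻¹`, `θ_f := σ_f ∘ τ ∘ σ_f⁻¹` — so `θ_f(x) = y(1-xf)⁻¹`, `θ_f(y) = (1-(x+y)f)(1-xf)⁻¹x`,
and Ohno's relation for a linear map `Z` on `y𝔥x` says exactly `Z ∘ θ_f = Z` for all `f` (duality is
`f = 0`) — and let `τ_λ` be the HSS anti-involution `x ↦ (1+yxλ)⁻¹y`, `y ↦ x(1+yxλ)`.  With `S = σ_ξ σ_η`,
`λ = ξη`, `u = 1-xξ`, `v = 1-xη`, `c = (uv)⁻¹ = v⁻¹u⁻¹`, `h = 1 + y c x ξη`, `N = uv + yxξη`, the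
extended-double-Ohno anti-involution `Θ = S ∘ (y w x ↦ y·τ_λ(w)·x) ∘ S⁻¹ = Ad_h ∘ (S τ_λ S⁻¹)` of `y𝔥̂x`
has generator images `Θ(x) = y c h⁻¹` and `Θ(y) = (h - ycξ) h⁻¹ (h - ycη) x`, and THEOREM A of the note
is the identity of anti-automorphisms `Θ = θ_ξ ∘ τ ∘ θ_η`; THEOREM B (every linear functional with Ohno's
relation satisfies the extended double Ohno relation of Hirose–Sato–Seki, so that `EDO_W = Ohno_W` in every
weight `W`) follows by three applications of Ohno-invariance.

A continuous anti-automorphism of `𝔥̂` is determined by the images of `x` and `y`, so THEOREM A reduces to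
identities between explicit noncommutative rational expressions in `x, y` and the central parameters
`ξ, η`.  This file checks those identities in an ARBITRARY ring `A` (elements `x y ξ η : A`, with `ξ, η`
commuting with `x, y` and with each other where needed, and the relevant invertible elements given as
units `u v N W : Aˣ` together with the equations saying what they are):

* `theta_fix_add`    : `θ_f(x) + θ_f(y) = y u⁻¹ + (1 - y u⁻¹ f) x = x + y`            (FACT 0 of the note);
* `h_mul_uv`         : `h·(uv) = N` — hence `h⁻¹ = uv N⁻¹` and `Θ(x) = y c h⁻¹ = y N⁻¹`     (step (i));
* `h_sub_left/right` : `h - ycξ = 1 - y u⁻¹ ξ` and `h - ycη = 1 - y v⁻¹ η`                (step (i));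
* `phiX_denominator` : `(1 - θ_ξ(y) η)·u = N` — hence `θ_ξτθ_η(x) = θ_ξ(x)(1 - θ_ξ(y)η)⁻¹ = y u⁻¹ (N u⁻¹)⁻¹
                       = y N⁻¹ = Θ(x)`                                                     (step (ii));
* `phiY_generic`     : `(1 - (a+b)η) W⁻¹ b = a + b - a W⁻¹` for `W = 1 - bη`; with `a = θ_ξ(x)`,
                       `b = θ_ξ(y)` (so `a + b = x + y` by `theta_fix_add`) this is
                       `θ_ξτθ_η(y) = (1 - θ_ξ(x+y)η)(1 - θ_ξ(y)η)⁻¹ θ_ξ(y) = x + y - θ_ξτθ_η(x)`     (step (iii));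
* `thetaEDO_y`       : `(1 - y u⁻¹ ξ)(uv N⁻¹)(1 - y v⁻¹ η) x = x + y - y N⁻¹`, i.e. `Θ(y) = x + y - Θ(x)`
                                                                                             (step (iv)).

Together: `Θ` and `θ_ξ ∘ τ ∘ θ_η` agree on `x` (both `y N⁻¹`) and on `y` (both `x + y - y N⁻¹`).  The passage
from generator images to anti-automorphisms of the completed free algebra and from THEOREM A to THEOREM B
stays on paper (edo-note.md §§2–3); the exact linear algebra `EDO_W = Ohno_W`, `4 ≤ W ≤ 11`, is in the
note's §4.  Only `Mathlib` is imported; no Literature or Summit declaration is used; `KZPeriodConjecture`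
is not touched.
-/

namespace Summit.KontsevichZagierPeriods.KontsevichZagierPeriods.Theorems

namespace EdoOhnoGenerators

variable {A : Type*} [Ring A]

/-- FACT 0: `θ_f(x) + θ_f(y) = y u⁻¹ + (1 - y u⁻¹ f) x = x + y` for `u = 1 - x f` and `f` commuting with `x`. -/
theorem theta_fix_add (x y f : A) (u : Aˣ) (hu : (u : A) = 1 - x * f) (hfx : Commute f x) :
    y * ↑u⁻¹ + (1 - y * ↑u⁻¹ * f) * x = x + y := by
  calc y * ↑u⁻¹ + (1 - y * ↑u⁻¹ * f) * x = x + y * ↑u⁻¹ * (1 - f * x) := by noncomm_ring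
    _ = x + y := by rw [hfx.eq, ← hu, Units.inv_mul_cancel_right]

/-- Step (i): `h · (u v) = N`, where `h = 1 + y (v⁻¹ u⁻¹) x ξ η`, `u = 1 - xξ`, `v = 1 - xη`,
`N = (1 - xξ)(1 - xη) + y x ξ η`.  Hence `h⁻¹ = u v N⁻¹` and `Θ(x) = y (uv)⁻¹ h⁻¹ = y N⁻¹`. -/
theorem h_mul_uv (x y ξ η : A) (u v : Aˣ) (hu : (u : A) = 1 - x * ξ) (hv : (v : A) = 1 - x * η)
    (hξx : Commute ξ x) (hηx : Commute η x) (hξη : Commute ξ η) :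
    (1 + y * (↑v⁻¹ * ↑u⁻¹) * x * ξ * η) * (↑u * ↑v) = (1 - x * ξ) * (1 - x * η) + y * x * ξ * η := by
  -- `x ξ η` commutes with `x`, `ξ`, `η`, hence with `u` and `v`
  have cx : Commute (x * ξ * η) x := ((Commute.refl x).mul_left hξx).mul_left hηx
  have cξ : Commute (x * ξ * η) ξ := (hξx.symm.mul_left (Commute.refl ξ)).mul_left hξη.symm
  have cη : Commute (x * ξ * η) η := (hηx.symm.mul_left hξη).mul_left (Commute.refl η)
  have cu : Commute (x * ξ * η) (↑u : A) := by
    rw [hu]; exact (Commute.one_right _).sub_right (cx.mul_right cξ)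
  have cv : Commute (x * ξ * η) (↑v : A) := by
    rw [hv]; exact (Commute.one_right _).sub_right (cx.mul_right cη)
  have e1 : (↑v⁻¹ * ↑u⁻¹ : A) * (x * ξ * η) * (↑u * ↑v) = x * ξ * η := by
    calc (↑v⁻¹ * ↑u⁻¹ : A) * (x * ξ * η) * (↑u * ↑v)
        = ↑v⁻¹ * ((↑u⁻¹ : A) * (x * ξ * η) * ↑u) * ↑v := by noncomm_ring
      _ = ↑v⁻¹ * (x * ξ * η) * ↑v := by rw [← cu.units_inv_right.eq, Units.inv_mul_cancel_right]
      _ = x * ξ * η := by rw [← cv.units_inv_right.eq, Units.inv_mul_cancel_right]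
  calc (1 + y * (↑v⁻¹ * ↑u⁻¹) * x * ξ * η) * (↑u * ↑v)
      = ↑u * ↑v + y * ((↑v⁻¹ * ↑u⁻¹ : A) * (x * ξ * η) * (↑u * ↑v)) := by noncomm_ring
    _ = ↑u * ↑v + y * (x * ξ * η) := by rw [e1]
    _ = (1 - x * ξ) * (1 - x * η) + y * x * ξ * η := by rw [hu, hv]; noncomm_ring

/-- Step (i): `h - y c ξ = 1 - y u⁻¹ ξ` (`c = v⁻¹ u⁻¹`, `u = 1 - xξ`, `v = 1 - xη`). -/
theorem h_sub_left (x y ξ η : A) (u v : Aˣ) (hu : (u : A) = 1 - x * ξ) (hv : (v : A) = 1 - x * η)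
    (hξx : Commute ξ x) (hηx : Commute η x) (hξη : Commute ξ η) :
    (1 + y * (↑v⁻¹ * ↑u⁻¹) * x * ξ * η) - y * (↑v⁻¹ * ↑u⁻¹) * ξ = 1 - y * ↑u⁻¹ * ξ := by
  have cξv : Commute ξ (↑v : A) := by
    rw [hv]; exact (Commute.one_right ξ).sub_right (hξx.mul_right hξη)
  have cuv : Commute (↑u : A) ↑v := by
    rw [hu, hv]
    exact (Commute.one_left _).sub_left ((Commute.one_right _).sub_right
      (((Commute.refl x).mul_right hηx.symm).mul_left (hξx.mul_right hξη)))
  have cu'v : Commute (↑u⁻¹ : A) ↑v := cuv.units_inv_left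
  have e : ξ - x * ξ * η = ξ * (1 - x * η) := by rw [← hξx.eq]; noncomm_ring
  calc (1 + y * (↑v⁻¹ * ↑u⁻¹) * x * ξ * η) - y * (↑v⁻¹ * ↑u⁻¹) * ξ
      = 1 - y * ↑v⁻¹ * ↑u⁻¹ * (ξ - x * ξ * η) := by noncomm_ring
    _ = 1 - y * ↑v⁻¹ * ↑u⁻¹ * (ξ * ↑v) := by rw [e, ← hv]
    _ = 1 - y * ↑v⁻¹ * (↑u⁻¹ * ↑v) * ξ := by rw [cξv.eq]; noncomm_ring
    _ = 1 - y * ↑v⁻¹ * (↑v * ↑u⁻¹) * ξ := by rw [cu'v.eq]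
    _ = 1 - y * ↑u⁻¹ * ξ := by rw [mul_assoc y, Units.inv_mul_cancel_left]

/-- Step (i): `h - y c η = 1 - y v⁻¹ η` (`c = v⁻¹ u⁻¹`, `u = 1 - xξ`); no commutation is needed here. -/
theorem h_sub_right (x y ξ η : A) (u v : Aˣ) (hu : (u : A) = 1 - x * ξ) :
    (1 + y * (↑v⁻¹ * ↑u⁻¹) * x * ξ * η) - y * (↑v⁻¹ * ↑u⁻¹) * η = 1 - y * ↑v⁻¹ * η := by
  calc (1 + y * (↑v⁻¹ * ↑u⁻¹) * x * ξ * η) - y * (↑v⁻¹ * ↑u⁻¹) * η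
      = 1 - y * ↑v⁻¹ * ((↑u⁻¹ : A) * (1 - x * ξ)) * η := by noncomm_ring
    _ = 1 - y * ↑v⁻¹ * η := by rw [← hu, Units.inv_mul, mul_one]

/-- Step (ii): the denominator of `θ_ξ τ θ_η (x) = θ_ξ(x) · (1 - θ_ξ(y) η)⁻¹`, multiplied by `u`, is `N`:
`(1 - (1-(x+y)ξ) u⁻¹ x η) · u = (1-xξ)(1-xη) + yxξη`.  Hence `θ_ξτθ_η(x) = y u⁻¹ (N u⁻¹)⁻¹ = y N⁻¹ = Θ(x)`. -/
theorem phiX_denominator (x y ξ η : A) (u : Aˣ) (hu : (u : A) = 1 - x * ξ)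
    (hξx : Commute ξ x) (hηx : Commute η x) (hξη : Commute ξ η) :
    (1 - (1 - (x + y) * ξ) * ↑u⁻¹ * x * η) * ↑u = (1 - x * ξ) * (1 - x * η) + y * x * ξ * η := by
  have c : Commute (x * η) (↑u : A) := by
    rw [hu]
    exact (Commute.one_right _).sub_right
      (((Commute.refl x).mul_right hξx.symm).mul_left (hηx.mul_right hξη.symm))
  have e1 : (↑u⁻¹ : A) * (x * η) * ↑u = x * η := by
    rw [← c.units_inv_right.eq, Units.inv_mul_cancel_right]
  have e2 : y * x * ξ * η = y * (ξ * x) * η := by rw [hξx.eq]; noncomm_ring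
  calc (1 - (1 - (x + y) * ξ) * ↑u⁻¹ * x * η) * ↑u
      = ↑u - (1 - (x + y) * ξ) * ((↑u⁻¹ : A) * (x * η) * ↑u) := by noncomm_ring
    _ = ↑u - (1 - (x + y) * ξ) * (x * η) := by rw [e1]
    _ = (1 - x * ξ) * (1 - x * η) + y * x * ξ * η := by rw [hu, e2]; noncomm_ring

/-- Step (iii), generic form: for `W = 1 - bη` a unit and `η` commuting with `b`,
`(1 - (a+b)η) W⁻¹ b = a + b - a W⁻¹`.  Applied with `a = θ_ξ(x)`, `b = θ_ξ(y)` (so `a + b = x + y` by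
`theta_fix_add`) it gives `θ_ξ τ θ_η (y) = (x + y) - θ_ξ τ θ_η (x)`. -/
theorem phiY_generic (a b η : A) (W : Aˣ) (hW : (W : A) = 1 - b * η) (hηb : Commute η b) :
    (1 - (a + b) * η) * ↑W⁻¹ * b = a + b - a * ↑W⁻¹ := by
  have hηW : Commute η (↑W : A) := by
    rw [hW]; exact (Commute.one_right η).sub_right (hηb.mul_right (Commute.refl η))
  have hηW' : Commute η (↑W⁻¹ : A) := hηW.units_inv_right
  have e1 : (1 - (a + b) * η) = ↑W - a * η := by rw [hW]; noncomm_ring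
  have e3 : b * η = 1 - ↑W := by rw [hW, sub_sub_cancel]
  have e2 : η * ↑W⁻¹ * b = ↑W⁻¹ - 1 := by
    have h4 : η * ↑W⁻¹ * b = ↑W⁻¹ * (b * η) := by rw [hηW'.eq, mul_assoc, hηb.eq]
    rw [h4, e3, mul_sub, mul_one, Units.inv_mul]
  rw [e1]
  calc (↑W - a * η) * ↑W⁻¹ * b = ↑W * ↑W⁻¹ * b - a * (η * ↑W⁻¹ * b) := by noncomm_ring
    _ = b - a * (↑W⁻¹ - 1) := by rw [Units.mul_inv, one_mul, e2]
    _ = a + b - a * ↑W⁻¹ := by noncomm_ring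

/-- Step (iv): `Θ(y) = x + y - Θ(x)`, i.e.
`(1 - y u⁻¹ ξ)(u v N⁻¹)(1 - y v⁻¹ η) x = x + y - y N⁻¹`
for units `u = 1 - xξ`, `v = 1 - xη`, `N = (1-xξ)(1-xη) + yxξη`, with `ξ, η` commuting with `x, y` and
with each other. -/
theorem thetaEDO_y (x y ξ η : A) (u v N : Aˣ) (hu : (u : A) = 1 - x * ξ) (hv : (v : A) = 1 - x * η)
    (hN : (N : A) = (1 - x * ξ) * (1 - x * η) + y * x * ξ * η)
    (hξx : Commute ξ x) (hηx : Commute η x) (hξy : Commute ξ y) (hξη : Commute ξ η) :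
    (1 - y * ↑u⁻¹ * ξ) * (↑u * ↑v * ↑N⁻¹) * (1 - y * ↑v⁻¹ * η) * x = x + y - y * ↑N⁻¹ := by
  -- commutation facts
  have cξu : Commute ξ (↑u : A) := by
    rw [hu]; exact (Commute.one_right ξ).sub_right (hξx.mul_right (Commute.refl ξ))
  have cxv : Commute x (↑v : A) := by
    rw [hv]; exact (Commute.one_right x).sub_right ((Commute.refl x).mul_right hηx.symm)
  have cηxv : Commute (η * x) (↑v : A) := by
    rw [hv]
    exact (Commute.one_right _).sub_right
      ((hηx.mul_right (Commute.refl η)).mul_left ((Commute.refl x).mul_right hηx.symm))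
  have cξN : Commute ξ (↑N : A) := by
    rw [hN]
    refine Commute.add_right ?_ ?_
    · exact ((Commute.one_right ξ).sub_right (hξx.mul_right (Commute.refl ξ))).mul_right
        ((Commute.one_right ξ).sub_right (hξx.mul_right hξη))
    · exact ((hξy.mul_right hξx).mul_right (Commute.refl ξ)).mul_right hξη
  have cξN' : Commute ξ (↑N⁻¹ : A) := cξN.units_inv_right
  -- (1) (1 - y u⁻¹ ξ) u = u - y ξ
  have e1 : (1 - y * ↑u⁻¹ * ξ) * (↑u : A) = ↑u - y * ξ := by
    have h1 : (↑u⁻¹ : A) * ξ * ↑u = ξ := by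
      rw [← cξu.units_inv_right.eq, Units.inv_mul_cancel_right]
    calc (1 - y * ↑u⁻¹ * ξ) * (↑u : A) = ↑u - y * ((↑u⁻¹ : A) * ξ * ↑u) := by noncomm_ring
      _ = ↑u - y * ξ := by rw [h1]
  -- (2) (1 - y v⁻¹ η) x v = x v - y η x
  have e2 : (1 - y * ↑v⁻¹ * η) * x * (↑v : A) = x * ↑v - y * (η * x) := by
    have h2 : (↑v⁻¹ : A) * (η * x) * ↑v = η * x := by
      rw [← cηxv.units_inv_right.eq, Units.inv_mul_cancel_right]
    calc (1 - y * ↑v⁻¹ * η) * x * (↑v : A) = x * ↑v - y * ((↑v⁻¹ : A) * (η * x) * ↑v) := by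
          noncomm_ring
      _ = x * ↑v - y * (η * x) := by rw [h2]
  -- right-multiply the goal by the unit v
  rw [← Units.mul_left_inj v]
  have lhs : (1 - y * ↑u⁻¹ * ξ) * (↑u * ↑v * ↑N⁻¹) * (1 - y * ↑v⁻¹ * η) * x * ↑v
      = ((1 - y * ↑u⁻¹ * ξ) * ↑u) * ↑v * ↑N⁻¹ * ((1 - y * ↑v⁻¹ * η) * x * ↑v) := by noncomm_ring
  rw [lhs, e1, e2]
  -- (3) (u - yξ) v N⁻¹ = 1 - y ξ N⁻¹, since (u - yξ) v = N - y ξ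
  have e3' : y * x * ξ * η = y * (ξ * x) * η := by rw [hξx.eq]; noncomm_ring
  have e3 : ((↑u : A) - y * ξ) * ↑v = ↑N - y * ξ := by
    rw [hu, hv, hN, e3']; noncomm_ring
  have e4 : ((↑u : A) - y * ξ) * ↑v * ↑N⁻¹ = 1 - y * ξ * ↑N⁻¹ := by
    rw [e3, sub_mul, Units.mul_inv]
  rw [e4]
  -- (4) the key polynomial identity: v - ξ (x v - y η x) = N
  have e5 : (↑v : A) - ξ * (x * ↑v - y * (η * x)) = ↑N := by
    rw [hv, hN]
    simp only [mul_sub, sub_mul, mul_one, one_mul, mul_assoc, hξx.eq, hηx.eq, hξx.left_comm,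
      hξy.left_comm]
    all_goals noncomm_ring
  have e6 : y * ξ * ↑N⁻¹ * (x * ↑v - y * (η * x)) = y * ↑N⁻¹ * (↑v - ↑N) := by
    rw [← e5]
    have h6 : (↑v : A) - (↑v - ξ * (x * ↑v - y * (η * x))) = ξ * (x * ↑v - y * (η * x)) := by abel
    rw [h6, mul_assoc y ξ (↑N⁻¹ : A), cξN'.eq]; noncomm_ring
  calc (1 - y * ξ * ↑N⁻¹) * (x * ↑v - y * (η * x))
      = x * ↑v - y * (η * x) - y * ξ * ↑N⁻¹ * (x * ↑v - y * (η * x)) := by noncomm_ring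
    _ = x * ↑v - y * (η * x) - y * ↑N⁻¹ * (↑v - ↑N) := by rw [e6]
    _ = x * ↑v - y * (η * x) - (y * ↑N⁻¹ * ↑v - y) := by rw [mul_sub, Units.inv_mul_cancel_right]
    _ = (x + y - y * ↑N⁻¹) * ↑v := by
          rw [hv, hηx.eq]; noncomm_ring

end EdoOhnoGenerators

end Summit.KontsevichZagierPeriods.KontsevichZagierPeriods.Theorems
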